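import Summits.Ventures.PackingBounds.ThreePointCert.T15d11AggF1
import Summits.Ventures.PackingBounds.ThreePointCert.CheckDim3

/-!
# Tammes θ(15) ≤ arccos(717/1250) = 54.9984° (A(3, 0.5736) ≤ 14): kernel validation of the blocks of (i') and of the `FI` expansion (part 9)

Framing: lottery ticket; floor = certified bounds/negative ranges. Venture `PackingBounds` (cell
`pub-packcert`), three-point SDP family. Integer data of a feasible point of the Bachoc–Vallentin
semidefinite program (n = 3, s = 717/1250, degree d = 11, Bachoc–Vallentin
multiplier set = cell mode sym2), derived by `cert2lean_s2.py` (sdp gen 5 fork of cert2lean_lp.py) from the exact rational certificate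
`sdp-n3-d11-s717-1250-sym2f-lpclient-v1.json` of the cell (exact verifier #1 + verifier #2 of the other seat), in the units of the kernel
checker `ThreePointCert.Check` + `CheckSym2` (soundness `card_le_of_cert3S2`); Gram factors offset-encoded for the
Kronecker-packed chunk validation `ThreePointCert.CheckKron` (emitter `emitleanS2.py` = lp gen 3 emitleanK.py). Generated file: plain
lists of integers / monomials.
-/

namespace Summit.Ventures.PackingBounds.ThreePointCert.T15d11

open Literature.Geometry.DiscreteGeometry Literature.Geometry.DiscreteGeometry.PolyCert PolyCert.SPoly

set_option maxRecDepth 100000 in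
set_option maxHeartbeats 0 in
/-- `FI` expansion on `S²` (Chebyshev kernels `QI3`), blocks [6] (kernel, trie residual). -/
theorem okF_7 : FchunkOK3 T15d11.cert.d [FBlk.mk 6 T15d11.fw6] T15d11.dFc6 T15d11.dFc7 = true := by
  decide +kernel

end Summit.Ventures.PackingBounds.ThreePointCert.T15d11
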